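import Summits.ValiantsHypothesis.ValiantsHypothesis.Theorems.LacunarySymmetroidDoorA26ExtremalInverseRankThree
import Summits.ValiantsHypothesis.ValiantsHypothesis.Theorems.LacunarySymmetroidMatrixDescartesCensusBox20

/-!
# Route `LacunarySymmetroid` — crux `DoorA26` (stmt-ValiantsHypothesis-19979): the rank-three normal form AT THE SUPPORT LEVEL, and what the
# census line's kernel support theorems say about generalized-Vandermonde minors

`…DoorA26ExtremalInverseRankThree` (p661156) proved the FORMAT-level normal form `PosRootLawAt 2 6 19 ↔ every real symmetric rank-≤ 3 matrix has ≤ 19 positive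
roots on the moment curve ↔ every would-be Gram has rank ≥ 4`.  The same argument is support-local; this file records the SUPPORT-level form, which is the currency
of the census line (`Census.PosRootLawOn 2 6 19 d`, all the `doorA26_on_…` / `doorA26_box…` theorems):

* `posRootLawOn_two_six_iff_rank_le_three d` — **`ζ(2,6; d) ≤ 19` ⟺ every real symmetric `6 × 6` matrix of rank `≤ 3` has `gramPoly d M` with at most `19` positive roots**;
* `posRootLawOn_two_six_iff_four_le_rank_extremalGram d` — **⟺ every would-be Gram `extremalGram E σ r c` with position data for `d` has rank `≥ 4`**;
* `posRootLawOn_of_det_submatrix_ne_zero d ρ γ` — a NON-ZERO `4 × 4` MINOR (rows `ρ`, columns `γ`) of every would-be Gram on `d` closes door A on `d`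
  (`four_le_rank_of_det_submatrix_ne_zero`: Mathlib `rank_submatrix_le` + `rank_of_isUnit`) — the bridge any future (true) signed-minor law would use;
  CAUTION (door-p4 g11 memo rev 4 §6): the natural candidate «leading principal minor < 0 on the census problem chambers» is FALSE (it changes sign between clustered
  and separated root configurations), so no instance of this bridge is currently located;
* the dictionary read BACKWARDS on kernel census theorems: `four_le_rank_extremalGram_of_posRootLawOn` and, as instances,
  `four_le_rank_extremalGram_box20` (every support inside a window of width `20`, `Census.doorA26_box20`) — **on every BOX-20 support, the Gram read off ANY twenty
  positive points through the signed maximal minors of the `20 × 21` generalized Vandermonde has rank ≥ 4** — a statement of linear algebra / total positivity that the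
  census certificates prove without ever mentioning roots.

HONEST FRAMING.  Exact reformulations and corollaries of kernel theorems (zero slack); `DoorA26` (OPEN, stmt-ValiantsHypothesis-19979) is asserted nowhere; nothing on
`DoorA34`, `MatrixDescartes` (stmt-ValiantsHypothesis-18050), Conjecture B or `VP ≠ VNP`.  Closes no item (`--supports stmt-ValiantsHypothesis-19979`, helper).
val-sym-door-p4 g11 (cell pub-symmetroid), 2026-08-28.  [folklore] spectral theorem / rank of a non-singular submatrix; the tree's Gram dictionary and census theorems.
-/

-- `Summit.ValiantsHypothesis.ValiantsHypothesis.…` repeats a component by the D-0017 layout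
-- (single-conjunct summit), which the `dupNamespace` linter flags; the name is mandated.
set_option linter.dupNamespace false

namespace Summit.ValiantsHypothesis.ValiantsHypothesis.Theorems.LacunarySymmetroid.DoorA26.ExtremalInverse

open Polynomial Matrix Finset
open scoped BigOperators
open Summit.ValiantsHypothesis.ValiantsHypothesis.Theorems.LacunarySymmetroidMatrixDescartes (PosRootLawOn)
open Summit.ValiantsHypothesis.ValiantsHypothesis.Theorems.LacunarySymmetroidMatrixDescartes.Census (doorA26_box20)

/-! ### 1. The support-level normal form -/

/-- **Rank-three normal form on one support**: `PosRootLawOn 2 6 19 d ↔` every real symmetric `6 × 6` matrix `M` with `rank M ≤ 3` has `gramPoly d M` with at most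
`19` distinct positive roots.  (Trichotomy `trichotomy_of_rank_le_three`: symmetroid Grams are pencils on the SAME support, `−M` has the same roots, sums of squares carry
`≤ 5` roots.) [folklore] -/
theorem posRootLawOn_two_six_iff_rank_le_three (d : Fin 6 → ℕ) :
    PosRootLawOn 2 6 19 d ↔
      ∀ M : Matrix (Fin 6) (Fin 6) ℝ, M.IsSymm → M.rank ≤ 3 → ((gramPoly d M).roots.toFinset.filter (fun t => 0 < t)).card ≤ 19 := by
  constructor
  · intro hlaw M hM hr
    have hsym : ∀ M' : Matrix (Fin 6) (Fin 6) ℝ, IsSymmetroidGram M' →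
        ((gramPoly d M').roots.toFinset.filter (fun t => 0 < t)).card ≤ 19 := by
      intro M' hM'
      obtain ⟨v, u, w, rfl⟩ := hM'
      have h := hlaw (fun l => !![v l + u l, w l; w l, v l - u l]) (blocks_isSymm v u w)
      rwa [det_eq_gramPoly d _ (blocks_isSymm v u w), gram_blocks] at h
    have hneg : ∀ M' : Matrix (Fin 6) (Fin 6) ℝ, (gramPoly d (-M')).roots = (gramPoly d M').roots := by
      intro M'; rw [gramPoly_neg, Polynomial.roots_neg]
    rcases trichotomy_of_rank_le_three M hM hr with h1 | h2 | ⟨t, a, h3⟩ | ⟨t, a, h4⟩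
    · exact hsym M h1
    · rw [← hneg]; exact hsym (-M) h2
    · rw [h3]; exact (card_posRoots_sos_le d t a).trans (by norm_num)
    · rw [← hneg, h4]; exact (card_posRoots_sos_le d t a).trans (by norm_num)
  · intro hrank S hS
    rw [det_eq_gramPoly d S hS]
    exact hrank (gram S) (gram_isSymm S) (rank_le_three_of_isSymmetroidGram _ (gram_isSymmetroidGram S))

/-- **Rank-four form on one support**: `PosRootLawOn 2 6 19 d ↔` every would-be Gram with position data for `d` has rank `≥ 4`. [folklore] -/
theorem posRootLawOn_two_six_iff_four_le_rank_extremalGram (d : Fin 6 → ℕ) :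
    PosRootLawOn 2 6 19 d ↔
      ∀ (E : Fin 21 → ℕ) (σ : Fin 6 → Fin 6 → Fin 21) (r : Fin 20 → ℝ) (c : ℝ),
        StrictMono E → (∀ i j, σ i j = σ j i) → (∀ i j, E (σ i j) = d i + d j) → (∀ k, ∃ i j, σ i j = k) →
        StrictMono r → 0 < r 0 → c ≠ 0 → 4 ≤ (extremalGram E σ r c).rank := by
  rw [posRootLawOn_two_six_iff_rank_le_three]
  constructor
  · intro h E σ r c hE hσ hEσ hsurj hr hr0 hc
    by_contra hlt
    have h19 := h (extremalGram E σ r c) (extremalGram_isSymm E σ hσ r c) (by omega)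
    have h20 := card_roots_gramPoly_extremalGram d E σ r c hE hσ hEσ hsurj hr hr0 hc
    omega
  · intro h M hM hr
    by_contra hlt
    obtain ⟨E, σ, r, c, hE, hσ, hEσ, hsurj, hrm, hr0, hc, hMe⟩ := stub_extremalInverse d M hM (by omega)
    have h4 := h E σ r c hE hσ hEσ hsurj hrm hr0 hc
    rw [← hMe] at h4
    omega

/-! ### 2. The minor bridge -/

/-- A non-singular `4 × 4` submatrix forces rank `≥ 4`. [folklore] -/
theorem four_le_rank_of_det_submatrix_ne_zero (M : Matrix (Fin 6) (Fin 6) ℝ) (ρ γ : Fin 4 → Fin 6)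
    (h : (M.submatrix ρ γ).det ≠ 0) : 4 ≤ M.rank := by
  have hu : IsUnit (M.submatrix ρ γ) := (Matrix.isUnit_iff_isUnit_det _).2 (isUnit_iff_ne_zero.2 h)
  have h4 : (M.submatrix ρ γ).rank = 4 := by
    rw [Matrix.rank_of_isUnit _ hu, Fintype.card_fin]
  have := Matrix.rank_submatrix_le M ρ γ
  omega

/-- **A non-zero `4 × 4` minor of every would-be Gram on `d` closes door A on `d`** (hypothesis stated inline, NOT asserted; no instance is currently located —
see the module docstring's CAUTION). [folklore] -/
theorem posRootLawOn_of_det_submatrix_ne_zero (d : Fin 6 → ℕ) (ρ γ : Fin 4 → Fin 6)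
    (h : ∀ (E : Fin 21 → ℕ) (σ : Fin 6 → Fin 6 → Fin 21) (r : Fin 20 → ℝ) (c : ℝ),
      StrictMono E → (∀ i j, σ i j = σ j i) → (∀ i j, E (σ i j) = d i + d j) → (∀ k, ∃ i j, σ i j = k) →
      StrictMono r → 0 < r 0 → c ≠ 0 → ((extremalGram E σ r c).submatrix ρ γ).det ≠ 0) :
    PosRootLawOn 2 6 19 d :=
  (posRootLawOn_two_six_iff_four_le_rank_extremalGram d).2
    fun E σ r c hE hσ hEσ hsurj hr hr0 hc => four_le_rank_of_det_submatrix_ne_zero _ ρ γ (h E σ r c hE hσ hEσ hsurj hr hr0 hc)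

/-! ### 3. Reading kernel census theorems backwards: rank ≥ 4 of would-be Grams -/

/-- On a support where the census line has closed door A, EVERY would-be Gram has rank `≥ 4`. [folklore] -/
theorem four_le_rank_extremalGram_of_posRootLawOn (d : Fin 6 → ℕ) (hd : PosRootLawOn 2 6 19 d)
    (E : Fin 21 → ℕ) (σ : Fin 6 → Fin 6 → Fin 21) (r : Fin 20 → ℝ) (c : ℝ)
    (hE : StrictMono E) (hσ : ∀ i j, σ i j = σ j i) (hEσ : ∀ i j, E (σ i j) = d i + d j) (hsurj : ∀ k, ∃ i j, σ i j = k)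
    (hr : StrictMono r) (hr0 : 0 < r 0) (hc : c ≠ 0) : 4 ≤ (extremalGram E σ r c).rank :=
  (posRootLawOn_two_six_iff_four_le_rank_extremalGram d).1 hd E σ r c hE hσ hEσ hsurj hr hr0 hc

/-- **Instance (kernel BOX-20, `Census.doorA26_box20`): on every support inside a window of width `20`, the `6 × 6` Gram read off ANY twenty sorted positive
points through the signed maximal minors of the `20 × 21` generalized Vandermonde (`extremalGram`) has rank at least `4`.**  A statement about generalized-Vandermonde
minors with no pencil and no root count in it, proved by the census certificates. [folklore] -/
theorem four_le_rank_extremalGram_box20 (d : Fin 6 → ℕ) (hw : ∀ i j, d i ≤ d j + 20)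
    (E : Fin 21 → ℕ) (σ : Fin 6 → Fin 6 → Fin 21) (r : Fin 20 → ℝ) (c : ℝ)
    (hE : StrictMono E) (hσ : ∀ i j, σ i j = σ j i) (hEσ : ∀ i j, E (σ i j) = d i + d j) (hsurj : ∀ k, ∃ i j, σ i j = k)
    (hr : StrictMono r) (hr0 : 0 < r 0) (hc : c ≠ 0) : 4 ≤ (extremalGram E σ r c).rank :=
  four_le_rank_extremalGram_of_posRootLawOn d (doorA26_box20 d hw) E σ r c hE hσ hEσ hsurj hr hr0 hc

end Summit.ValiantsHypothesis.ValiantsHypothesis.Theorems.LacunarySymmetroid.DoorA26.ExtremalInverse
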